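import Mathlib

/-!
# Line `filtered_covering` of crux `OrbitDimensionBound` (stmt-ValiantsHypothesis-16133): audit of the open stub
`stub_jordanHolder` (Jordan–Hölder transport), part 1 — unfolded bookkeeping, scalar pencils are degeneration-closed, witnesses

Negative-lane lemmas (val-neg-1, refuter, 2026-08-28) for the audit of the registered, still OPEN stub `Stmt.stub_jordanHolder`
of the workfile `Cruxes/OrbitDimensionBound/Lines/filtered_covering.lean` (dormant rung `Depth.FilteredShadow`; stub 1
`stub_polystableModel` is closed by `Theorems/FreeSubtorusOrbitDimensionBoundStubPolystableModel.lean`).  As in that Theorems file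
the workfile's `IsDegeneration q X Y` ("`Y` is the weight-diagonal part of a constant gauge form `g X h` that is block-lower-
triangular for weights `a, b ≤ q` with `Σ a = Σ b`") and `IsDegenerationClosed X` ("every degeneration of `X` is a gauge form
of `X`") are UNFOLDED (`weightTruncate a b Z = Matrix.of fun i j => if a i = b j then Z i j else 0`); the unfolded texts are
definitionally the workfile's (checked `Iff.rfl` against `Lines/DepthLadder.lean`).  No `Cruxes/` import.  Contents:

* `jh_degZero_of_gauge`, `jh_gauge_of_degZero`, `jh_deg_refl` — depth `0` = constant gauge equivalence; reflexivity;
* `jh_det_truncate`, `jh_scalar_closed` — EVERY SCALAR PENCIL `p • 1` IS DEGENERATION-CLOSED (a gauge form of `p • 1` is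
  `p • (g h)`; its weight-diagonal part is `p • N'` with `det N' = det (g h) ≠ 0` by the Leibniz argument);
* the witnesses: the NON-SPLIT `2 × 2` pencil `A₀ = [[X, 0], [1, X]]` (`n = 1`; `det A₀ = X² ≠ 0`) degenerates to `X • 1`
  with weights `a = b = (0, 1)` (`jh_toy_deg`), and the two are gauge equivalent in neither direction (`jh_toy_not_gauge`,
  `jh_toy_not_gauge'`: constant parts of ranks `1` and `0`); the `1 × 1` pencils `[X]`, `[X + 1]` have `det ≠ 0` and are not
  gauge equivalent (`jh_line_det`, `jh_line'_det`, `jh_line_not_gauge`).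

Part 2 (`FilteredCoveringJordanHolderAudit.lean`) uses these to show which hypotheses of the stub are load-bearing and that its
hypotheses are simultaneously satisfiable.  Honest framing: [folklore] linear algebra; the stub is believed TRUE (King's
θ-stability, `θ = (-1, 1)`) and is NOT proved; nothing here bears on `OrbitDimensionBound`, `FreeSubtorus` or VP ≠ VNP (all OPEN).

## References (orientation only)
* A. D. King, Moduli of representations of finite-dimensional algebras, Quart. J. Math. 45 (1994), §2, Prop. 3.1.
-/

namespace Summit.ValiantsHypothesis.Theorems.OrbitDimensionBound.Negative.FilteredCovering

open Matrix MvPolynomial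

noncomputable section

/-! ## §1 Unfolded bookkeeping: gauge forms are the depth-`0` degenerations; reflexivity -/

/-- A constant gauge form `g A h` is a depth-`0` degeneration of `A` (weights `0`). [folklore] -/
theorem jh_degZero_of_gauge {n m : ℕ} (A B : Matrix (Fin m) (Fin m) (MvPolynomial (Fin n × Fin n) ℂ)) (g₀ h₀ : GL (Fin m) ℂ)
    (e : B = (g₀ : Matrix (Fin m) (Fin m) ℂ).map C * A * (h₀ : Matrix (Fin m) (Fin m) ℂ).map C) :
    (∃ (g h : GL (Fin m) ℂ) (a b : Fin m → ℕ),
      (∀ i, (a i : ℕ∞) ≤ 0) ∧ (∀ j, (b j : ℕ∞) ≤ 0) ∧ ∑ i, a i = ∑ j, b j ∧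
      (∀ i j, a i < b j →
        (g.val.map C * A * h.val.map C : Matrix (Fin m) (Fin m) (MvPolynomial (Fin n × Fin n) ℂ)) i j = 0) ∧
      B = Matrix.of fun i j => if a i = b j then
        (g.val.map C * A * h.val.map C : Matrix (Fin m) (Fin m) (MvPolynomial (Fin n × Fin n) ℂ)) i j else 0) := by
  refine ⟨g₀, h₀, fun _ => 0, fun _ => 0, fun _ => by simp, fun _ => by simp, rfl,
    fun i j hij => (lt_irrefl _ hij).elim, ?_⟩
  rw [e]
  ext i j
  simp

/-- A depth-`0` degeneration of `A` is a constant gauge form of `A` (both weight vectors vanish). [folklore] -/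
theorem jh_gauge_of_degZero {n m : ℕ} (A B : Matrix (Fin m) (Fin m) (MvPolynomial (Fin n × Fin n) ℂ))
    (hd : (∃ (g h : GL (Fin m) ℂ) (a b : Fin m → ℕ),
      (∀ i, (a i : ℕ∞) ≤ 0) ∧ (∀ j, (b j : ℕ∞) ≤ 0) ∧ ∑ i, a i = ∑ j, b j ∧
      (∀ i j, a i < b j →
        (g.val.map C * A * h.val.map C : Matrix (Fin m) (Fin m) (MvPolynomial (Fin n × Fin n) ℂ)) i j = 0) ∧
      B = Matrix.of fun i j => if a i = b j then
        (g.val.map C * A * h.val.map C : Matrix (Fin m) (Fin m) (MvPolynomial (Fin n × Fin n) ℂ)) i j else 0)) :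
    ∃ g₀ h₀ : GL (Fin m) ℂ, B = (g₀ : Matrix (Fin m) (Fin m) ℂ).map C * A * (h₀ : Matrix (Fin m) (Fin m) ℂ).map C := by
  obtain ⟨g, h, a, b, ha, hb, -, -, hB⟩ := hd
  have ha0 : ∀ i, a i = 0 := fun i => by exact_mod_cast nonpos_iff_eq_zero.mp (ha i)
  have hb0 : ∀ j, b j = 0 := fun j => by exact_mod_cast nonpos_iff_eq_zero.mp (hb j)
  refine ⟨g, h, ?_⟩
  rw [hB]
  ext i j
  simp [ha0, hb0]

/-- Every matrix is a depth-`q` degeneration of itself (`g = h = 1`, weights `0`). [folklore] -/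
theorem jh_deg_refl {n m : ℕ} (q : ℕ∞) (A : Matrix (Fin m) (Fin m) (MvPolynomial (Fin n × Fin n) ℂ)) :
    (∃ (g h : GL (Fin m) ℂ) (a b : Fin m → ℕ),
      (∀ i, (a i : ℕ∞) ≤ q) ∧ (∀ j, (b j : ℕ∞) ≤ q) ∧ ∑ i, a i = ∑ j, b j ∧
      (∀ i j, a i < b j →
        (g.val.map C * A * h.val.map C : Matrix (Fin m) (Fin m) (MvPolynomial (Fin n × Fin n) ℂ)) i j = 0) ∧
      A = Matrix.of fun i j => if a i = b j then
        (g.val.map C * A * h.val.map C : Matrix (Fin m) (Fin m) (MvPolynomial (Fin n × Fin n) ℂ)) i j else 0) := by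
  refine ⟨1, 1, fun _ => 0, fun _ => 0, fun _ => by simp, fun _ => by simp, rfl,
    fun i j hij => (lt_irrefl _ hij).elim, ?_⟩
  rw [Units.val_one (α := Matrix (Fin m) (Fin m) ℂ), Matrix.map_one C C_0 C_1, Matrix.one_mul, Matrix.mul_one]
  ext i j
  simp

/-! ## §2 Scalar pencils are degeneration-closed -/

/-- Leibniz: the weight-diagonal part of a matrix that is block-lower-triangular for weights with `Σ a = Σ b` has the same
determinant (a permutation either meets an entry with `a (σ i) < b i`, killing both products, or has all `a (σ i) ≥ b i`,
whence all equal). [folklore] -/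
theorem jh_det_truncate {m : ℕ} (a b : Fin m → ℕ) (N : Matrix (Fin m) (Fin m) ℂ)
    (hs : ∑ i, a i = ∑ j, b j) (hz : ∀ i j, a i < b j → N i j = 0) :
    (Matrix.of fun i j => if a i = b j then N i j else 0).det = N.det := by
  rw [Matrix.det_apply, Matrix.det_apply]
  refine Finset.sum_congr rfl fun σ _ => ?_
  congr 1
  by_cases hall : ∀ i, a (σ i) = b i
  · exact Finset.prod_congr rfl fun i _ => by simp [hall i]
  · push Not at hall
    obtain ⟨i₀, hi₀⟩ := hall
    have hL : (∏ i, (Matrix.of fun i j => if a i = b j then N i j else 0) (σ i) i) = 0 :=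
      Finset.prod_eq_zero (Finset.mem_univ i₀) (by simp [hi₀])
    have hR : (∏ i, N (σ i) i) = 0 := by
      by_contra hne
      have hge : ∀ i, b i ≤ a (σ i) := by
        intro i
        by_contra hlt
        push Not at hlt
        exact hne (Finset.prod_eq_zero (Finset.mem_univ i) (hz _ _ hlt))
      have hsum : ∑ i, b i = ∑ i, a (σ i) := by
        rw [Equiv.sum_comp σ a]; exact hs.symm
      have heq : ∀ i ∈ Finset.univ, b i = a (σ i) :=
        (Finset.sum_eq_sum_iff_of_le fun i _ => hge i).mp hsum
      exact hi₀ (heq i₀ (Finset.mem_univ _)).symm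
    rw [hL, hR]

/-- **Every scalar pencil `p • 1` is degeneration-closed**: a gauge form of `p • 1` is `p • (g h)`, its weight-diagonal part is
`p • N'` with `N'` the weight-diagonal part of the constant invertible matrix `g h`, and `det N' = det (g h) ≠ 0`
(`jh_det_truncate`), so the degeneration is the gauge form `N' · (p • 1) · 1`. [folklore] -/
theorem jh_scalar_closed {n m : ℕ} (p : MvPolynomial (Fin n × Fin n) ℂ) (S : Matrix (Fin m) (Fin m) (MvPolynomial (Fin n × Fin n) ℂ))
    (hS : S = p • 1) :
    (∀ B' : Matrix (Fin m) (Fin m) (MvPolynomial (Fin n × Fin n) ℂ),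
      (∃ (g h : GL (Fin m) ℂ) (a b : Fin m → ℕ),
        (∀ i, (a i : ℕ∞) ≤ ⊤) ∧ (∀ j, (b j : ℕ∞) ≤ ⊤) ∧ ∑ i, a i = ∑ j, b j ∧
        (∀ i j, a i < b j →
          (g.val.map C * S * h.val.map C : Matrix (Fin m) (Fin m) (MvPolynomial (Fin n × Fin n) ℂ)) i j = 0) ∧
        B' = Matrix.of fun i j => if a i = b j then
          (g.val.map C * S * h.val.map C : Matrix (Fin m) (Fin m) (MvPolynomial (Fin n × Fin n) ℂ)) i j else 0) →
      (∃ (g h : GL (Fin m) ℂ) (a b : Fin m → ℕ),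
        (∀ i, (a i : ℕ∞) ≤ 0) ∧ (∀ j, (b j : ℕ∞) ≤ 0) ∧ ∑ i, a i = ∑ j, b j ∧
        (∀ i j, a i < b j →
          (g.val.map C * S * h.val.map C : Matrix (Fin m) (Fin m) (MvPolynomial (Fin n × Fin n) ℂ)) i j = 0) ∧
        B' = Matrix.of fun i j => if a i = b j then
          (g.val.map C * S * h.val.map C : Matrix (Fin m) (Fin m) (MvPolynomial (Fin n × Fin n) ℂ)) i j else 0)) := by
  subst hS
  intro B hB
  obtain ⟨g, h, a, b, -, -, hs, hz, hB⟩ := hB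
  have key : (g : Matrix (Fin m) (Fin m) ℂ).map C * (p • (1 : Matrix (Fin m) (Fin m) (MvPolynomial (Fin n × Fin n) ℂ))) *
      (h : Matrix (Fin m) (Fin m) ℂ).map C =
      p • ((g : Matrix (Fin m) (Fin m) ℂ) * (h : Matrix (Fin m) (Fin m) ℂ)).map C := by
    rw [Matrix.mul_smul, Matrix.mul_one, Matrix.smul_mul, Matrix.map_mul]
  by_cases hp : p = 0
  · subst hp
    refine jh_degZero_of_gauge _ _ 1 1 ?_
    rw [hB]
    ext i j
    simp
  · have hz' : ∀ i j, a i < b j → ((g : Matrix (Fin m) (Fin m) ℂ) * (h : Matrix (Fin m) (Fin m) ℂ)) i j = 0 := by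
      intro i j hij
      have h0 := hz i j hij
      rw [key, Matrix.smul_apply, Matrix.map_apply, smul_eq_mul] at h0
      exact MvPolynomial.C_eq_zero.mp ((mul_eq_zero.mp h0).resolve_left hp)
    have hdet : (Matrix.of fun i j => if a i = b j then
        ((g : Matrix (Fin m) (Fin m) ℂ) * (h : Matrix (Fin m) (Fin m) ℂ)) i j else 0).det ≠ 0 := by
      rw [jh_det_truncate a b _ hs hz', Matrix.det_mul]
      exact mul_ne_zero (Matrix.isUnits_det_units g).ne_zero (Matrix.isUnits_det_units h).ne_zero
    refine jh_degZero_of_gauge _ _ (Matrix.GeneralLinearGroup.mkOfDetNeZero _ hdet) 1 ?_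
    rw [Matrix.GeneralLinearGroup.val_mkOfDetNeZero, Units.val_one (α := Matrix (Fin m) (Fin m) ℂ),
      Matrix.map_one C C_0 C_1, Matrix.mul_one, Matrix.mul_smul, Matrix.mul_one, hB]
    ext i j
    simp only [key, Matrix.of_apply, Matrix.smul_apply, Matrix.map_apply]
    split_ifs <;> simp

/-! ## §3 The witnesses: the non-split pencil `A₀ = [[X, 0], [1, X]]` versus `X • 1`; the `1 × 1` pencils `[X]`, `[X + 1]` -/

/-- Constant parts: `(N.map C).map constantCoeff = N`. [folklore] -/
theorem jh_map_constantCoeff_map_C {n m : ℕ} (N : Matrix (Fin m) (Fin m) ℂ) :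
    (N.map (C : ℂ → MvPolynomial (Fin n × Fin n) ℂ)).map MvPolynomial.constantCoeff = N := by
  ext i j
  simp

/-- Constant part of a scalar pencil. [folklore] -/
theorem jh_map_constantCoeff_smul_one {n m : ℕ} (p : MvPolynomial (Fin n × Fin n) ℂ) :
    (p • (1 : Matrix (Fin m) (Fin m) (MvPolynomial (Fin n × Fin n) ℂ))).map MvPolynomial.constantCoeff =
      MvPolynomial.constantCoeff p • (1 : Matrix (Fin m) (Fin m) ℂ) := by
  ext i j
  simp only [Matrix.map_apply, Matrix.smul_apply, Matrix.one_apply]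
  split_ifs <;> simp

/-- `det A₀ = X² ≠ 0` for the non-split pencil `A₀ = [[X, 0], [1, X]]`. [folklore] -/
theorem jh_toy_det (A₀ : Matrix (Fin 2) (Fin 2) (MvPolynomial (Fin 1 × Fin 1) ℂ))
    (hA : A₀ = !![X (0, 0), 0; 1, X (0, 0)]) : A₀.det ≠ 0 := by
  subst hA
  have hX : (X (0, 0) : MvPolynomial (Fin 1 × Fin 1) ℂ) ≠ 0 := MvPolynomial.X_ne_zero _
  have hdet : ((!![X (0, 0), 0; 1, X (0, 0)] : Matrix (Fin 2) (Fin 2) (MvPolynomial (Fin 1 × Fin 1) ℂ))).det =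
      X (0, 0) * X (0, 0) := by
    rw [Matrix.det_fin_two]; simp
  rw [hdet]
  exact mul_ne_zero hX hX

/-- `A₀ ⇝ X • 1` (weights `a = b = (0, 1)`, trivial gauge): a one-parameter degeneration (of any depth `≥ 1`, here `⊤`).
[folklore] -/
theorem jh_toy_deg (A₀ S₀ : Matrix (Fin 2) (Fin 2) (MvPolynomial (Fin 1 × Fin 1) ℂ))
    (hA : A₀ = !![X (0, 0), 0; 1, X (0, 0)]) (hS : S₀ = (X (0, 0) : MvPolynomial (Fin 1 × Fin 1) ℂ) • 1) :
    (∃ (g h : GL (Fin 2) ℂ) (a b : Fin 2 → ℕ),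
      (∀ i, (a i : ℕ∞) ≤ ⊤) ∧ (∀ j, (b j : ℕ∞) ≤ ⊤) ∧ ∑ i, a i = ∑ j, b j ∧
      (∀ i j, a i < b j →
        (g.val.map C * A₀ * h.val.map C : Matrix (Fin 2) (Fin 2) (MvPolynomial (Fin 1 × Fin 1) ℂ)) i j = 0) ∧
      S₀ = Matrix.of fun i j => if a i = b j then
        (g.val.map C * A₀ * h.val.map C : Matrix (Fin 2) (Fin 2) (MvPolynomial (Fin 1 × Fin 1) ℂ)) i j else 0) := by
  subst hA hS
  refine ⟨1, 1, ![0, 1], ![0, 1], fun _ => le_top, fun _ => le_top, rfl, ?_, ?_⟩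
  · intro i j hij
    rw [Units.val_one (α := Matrix (Fin 2) (Fin 2) ℂ), Matrix.map_one C C_0 C_1, Matrix.one_mul, Matrix.mul_one]
    fin_cases i <;> fin_cases j <;> simp_all
  · rw [Units.val_one (α := Matrix (Fin 2) (Fin 2) ℂ), Matrix.map_one C C_0 C_1, Matrix.one_mul, Matrix.mul_one]
    ext i j
    fin_cases i <;> fin_cases j <;> simp

/-- `X • 1` is NOT a gauge form of `A₀` (constant parts: `0` versus rank `1`). [folklore] -/
theorem jh_toy_not_gauge (A₀ S₀ : Matrix (Fin 2) (Fin 2) (MvPolynomial (Fin 1 × Fin 1) ℂ))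
    (hA : A₀ = !![X (0, 0), 0; 1, X (0, 0)]) (hS : S₀ = (X (0, 0) : MvPolynomial (Fin 1 × Fin 1) ℂ) • 1) :
    ¬ (∃ (g h : GL (Fin 2) ℂ) (a b : Fin 2 → ℕ),
      (∀ i, (a i : ℕ∞) ≤ 0) ∧ (∀ j, (b j : ℕ∞) ≤ 0) ∧ ∑ i, a i = ∑ j, b j ∧
      (∀ i j, a i < b j →
        (g.val.map C * A₀ * h.val.map C : Matrix (Fin 2) (Fin 2) (MvPolynomial (Fin 1 × Fin 1) ℂ)) i j = 0) ∧
      S₀ = Matrix.of fun i j => if a i = b j then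
        (g.val.map C * A₀ * h.val.map C : Matrix (Fin 2) (Fin 2) (MvPolynomial (Fin 1 × Fin 1) ℂ)) i j else 0) := by
  subst hS
  intro hd
  obtain ⟨g, h, e⟩ := jh_gauge_of_degZero _ _ hd
  have key := congrArg (fun M : Matrix (Fin 2) (Fin 2) (MvPolynomial (Fin 1 × Fin 1) ℂ) => M.map MvPolynomial.constantCoeff) e
  have hM : A₀.map MvPolynomial.constantCoeff = !![0, 0; 1, 0] := by
    subst hA; ext i j; fin_cases i <;> fin_cases j <;> simp
  simp only [Matrix.map_mul, jh_map_constantCoeff_map_C, jh_map_constantCoeff_smul_one, hM,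
    MvPolynomial.constantCoeff_X, zero_smul] at key
  have hE := congrArg (fun M : Matrix (Fin 2) (Fin 2) ℂ =>
    ((g⁻¹ : GL (Fin 2) ℂ) : Matrix (Fin 2) (Fin 2) ℂ) * M * ((h⁻¹ : GL (Fin 2) ℂ) : Matrix (Fin 2) (Fin 2) ℂ)) key
  have hE' : (!![0, 0; 1, 0] : Matrix (Fin 2) (Fin 2) ℂ) = 0 := by
    simpa [Matrix.mul_assoc] using hE.symm
  have h10 := congrFun (congrFun hE' 1) 0
  simp at h10

/-- `A₀` is NOT a gauge form of `X • 1` (constant parts: rank `1` versus `0`). [folklore] -/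
theorem jh_toy_not_gauge' (A₀ S₀ : Matrix (Fin 2) (Fin 2) (MvPolynomial (Fin 1 × Fin 1) ℂ))
    (hA : A₀ = !![X (0, 0), 0; 1, X (0, 0)]) (hS : S₀ = (X (0, 0) : MvPolynomial (Fin 1 × Fin 1) ℂ) • 1) :
    ¬ (∃ (g h : GL (Fin 2) ℂ) (a b : Fin 2 → ℕ),
      (∀ i, (a i : ℕ∞) ≤ 0) ∧ (∀ j, (b j : ℕ∞) ≤ 0) ∧ ∑ i, a i = ∑ j, b j ∧
      (∀ i j, a i < b j →
        (g.val.map C * S₀ * h.val.map C : Matrix (Fin 2) (Fin 2) (MvPolynomial (Fin 1 × Fin 1) ℂ)) i j = 0) ∧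
      A₀ = Matrix.of fun i j => if a i = b j then
        (g.val.map C * S₀ * h.val.map C : Matrix (Fin 2) (Fin 2) (MvPolynomial (Fin 1 × Fin 1) ℂ)) i j else 0) := by
  subst hS
  intro hd
  obtain ⟨g, h, e⟩ := jh_gauge_of_degZero _ _ hd
  have key := congrArg (fun M : Matrix (Fin 2) (Fin 2) (MvPolynomial (Fin 1 × Fin 1) ℂ) => M.map MvPolynomial.constantCoeff) e
  have hM : A₀.map MvPolynomial.constantCoeff = !![0, 0; 1, 0] := by
    subst hA; ext i j; fin_cases i <;> fin_cases j <;> simp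
  simp only [Matrix.map_mul, jh_map_constantCoeff_map_C, jh_map_constantCoeff_smul_one, hM,
    MvPolynomial.constantCoeff_X, zero_smul, Matrix.mul_zero, Matrix.zero_mul] at key
  have h10 := congrFun (congrFun key 1) 0
  simp at h10

/-- `det [X] = X ≠ 0`. [folklore] -/
theorem jh_line_det (T : Matrix (Fin 1) (Fin 1) (MvPolynomial (Fin 1 × Fin 1) ℂ))
    (hT : T = (X (0, 0) : MvPolynomial (Fin 1 × Fin 1) ℂ) • 1) : T.det ≠ 0 := by
  subst hT
  rw [Matrix.det_smul, Matrix.det_one, mul_one, Fintype.card_fin, pow_one]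
  exact MvPolynomial.X_ne_zero _

/-- `det [X + 1] = X + 1 ≠ 0` (constant coefficient `1`). [folklore] -/
theorem jh_line'_det (T' : Matrix (Fin 1) (Fin 1) (MvPolynomial (Fin 1 × Fin 1) ℂ))
    (hT' : T' = ((X (0, 0) : MvPolynomial (Fin 1 × Fin 1) ℂ) + 1) • 1) : T'.det ≠ 0 := by
  subst hT'
  rw [Matrix.det_smul, Matrix.det_one, mul_one, Fintype.card_fin, pow_one]
  intro h0
  simpa using congrArg MvPolynomial.constantCoeff h0

/-- `[X + 1]` is NOT a gauge form of `[X]` (constant parts `1` versus `0`). [folklore] -/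
theorem jh_line_not_gauge (T T' : Matrix (Fin 1) (Fin 1) (MvPolynomial (Fin 1 × Fin 1) ℂ))
    (hT : T = (X (0, 0) : MvPolynomial (Fin 1 × Fin 1) ℂ) • 1)
    (hT' : T' = ((X (0, 0) : MvPolynomial (Fin 1 × Fin 1) ℂ) + 1) • 1) :
    ¬ (∃ (g h : GL (Fin 1) ℂ) (a b : Fin 1 → ℕ),
      (∀ i, (a i : ℕ∞) ≤ 0) ∧ (∀ j, (b j : ℕ∞) ≤ 0) ∧ ∑ i, a i = ∑ j, b j ∧
      (∀ i j, a i < b j →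
        (g.val.map C * T * h.val.map C : Matrix (Fin 1) (Fin 1) (MvPolynomial (Fin 1 × Fin 1) ℂ)) i j = 0) ∧
      T' = Matrix.of fun i j => if a i = b j then
        (g.val.map C * T * h.val.map C : Matrix (Fin 1) (Fin 1) (MvPolynomial (Fin 1 × Fin 1) ℂ)) i j else 0) := by
  subst hT hT'
  intro hd
  obtain ⟨g, h, e⟩ := jh_gauge_of_degZero _ _ hd
  have key := congrArg (fun M : Matrix (Fin 1) (Fin 1) (MvPolynomial (Fin 1 × Fin 1) ℂ) => M.map MvPolynomial.constantCoeff) e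
  simp only [Matrix.map_mul, jh_map_constantCoeff_map_C, jh_map_constantCoeff_smul_one,
    MvPolynomial.constantCoeff_X, zero_smul, Matrix.mul_zero, Matrix.zero_mul, map_add,
    map_one, zero_add, one_smul] at key
  exact one_ne_zero key

/-! ## §4 The hypotheses of `stub_jordanHolder` are simultaneously satisfiable on a non-degenerate instance -/

/-- **`stub_jordanHolder` is not vacuous.**  All seven hypotheses `det A ≠ 0`, `A ⇝ B`, `A' ⇝ B`, `A ⇝ P`, `P` closed,
`A' ⇝ P'`, `P'` closed hold at `n = 1`, `m = 2`, `A = A' = A₀ = [[X, 0], [1, X]]`, `B = P = P' = X • 1`, where `P` is a genuine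
one-parameter degeneration of `A` (NOT a gauge form of it) and the conclusion `P ∼ P'` holds. [folklore] -/
theorem stub_jordanHolder_hypotheses_satisfiable :
    ∃ (n m : ℕ) (A A' B P P' : Matrix (Fin m) (Fin m) (MvPolynomial (Fin n × Fin n) ℂ)),
      A.det ≠ 0 ∧
      (∃ (g h : GL (Fin m) ℂ) (a b : Fin m → ℕ),
          (∀ i, (a i : ℕ∞) ≤ ⊤) ∧ (∀ j, (b j : ℕ∞) ≤ ⊤) ∧ ∑ i, a i = ∑ j, b j ∧
          (∀ i j, a i < b j →
            (g.val.map C * A * h.val.map C : Matrix (Fin m) (Fin m) (MvPolynomial (Fin n × Fin n) ℂ)) i j = 0) ∧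
          B = Matrix.of fun i j => if a i = b j then
            (g.val.map C * A * h.val.map C : Matrix (Fin m) (Fin m) (MvPolynomial (Fin n × Fin n) ℂ)) i j else 0) ∧
      (∃ (g h : GL (Fin m) ℂ) (a b : Fin m → ℕ),
          (∀ i, (a i : ℕ∞) ≤ ⊤) ∧ (∀ j, (b j : ℕ∞) ≤ ⊤) ∧ ∑ i, a i = ∑ j, b j ∧
          (∀ i j, a i < b j →
            (g.val.map C * A' * h.val.map C : Matrix (Fin m) (Fin m) (MvPolynomial (Fin n × Fin n) ℂ)) i j = 0) ∧
          B = Matrix.of fun i j => if a i = b j then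
            (g.val.map C * A' * h.val.map C : Matrix (Fin m) (Fin m) (MvPolynomial (Fin n × Fin n) ℂ)) i j else 0) ∧
      (∃ (g h : GL (Fin m) ℂ) (a b : Fin m → ℕ),
          (∀ i, (a i : ℕ∞) ≤ ⊤) ∧ (∀ j, (b j : ℕ∞) ≤ ⊤) ∧ ∑ i, a i = ∑ j, b j ∧
          (∀ i j, a i < b j →
            (g.val.map C * A * h.val.map C : Matrix (Fin m) (Fin m) (MvPolynomial (Fin n × Fin n) ℂ)) i j = 0) ∧
          P = Matrix.of fun i j => if a i = b j then
            (g.val.map C * A * h.val.map C : Matrix (Fin m) (Fin m) (MvPolynomial (Fin n × Fin n) ℂ)) i j else 0) ∧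
      (∀ B' : Matrix (Fin m) (Fin m) (MvPolynomial (Fin n × Fin n) ℂ),
          (∃ (g h : GL (Fin m) ℂ) (a b : Fin m → ℕ),
            (∀ i, (a i : ℕ∞) ≤ ⊤) ∧ (∀ j, (b j : ℕ∞) ≤ ⊤) ∧ ∑ i, a i = ∑ j, b j ∧
            (∀ i j, a i < b j →
              (g.val.map C * P * h.val.map C : Matrix (Fin m) (Fin m) (MvPolynomial (Fin n × Fin n) ℂ)) i j = 0) ∧
            B' = Matrix.of fun i j => if a i = b j then
              (g.val.map C * P * h.val.map C : Matrix (Fin m) (Fin m) (MvPolynomial (Fin n × Fin n) ℂ)) i j else 0) →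
          (∃ (g h : GL (Fin m) ℂ) (a b : Fin m → ℕ),
            (∀ i, (a i : ℕ∞) ≤ 0) ∧ (∀ j, (b j : ℕ∞) ≤ 0) ∧ ∑ i, a i = ∑ j, b j ∧
            (∀ i j, a i < b j →
              (g.val.map C * P * h.val.map C : Matrix (Fin m) (Fin m) (MvPolynomial (Fin n × Fin n) ℂ)) i j = 0) ∧
            B' = Matrix.of fun i j => if a i = b j then
              (g.val.map C * P * h.val.map C : Matrix (Fin m) (Fin m) (MvPolynomial (Fin n × Fin n) ℂ)) i j else 0)) ∧
      (∃ (g h : GL (Fin m) ℂ) (a b : Fin m → ℕ),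
          (∀ i, (a i : ℕ∞) ≤ ⊤) ∧ (∀ j, (b j : ℕ∞) ≤ ⊤) ∧ ∑ i, a i = ∑ j, b j ∧
          (∀ i j, a i < b j →
            (g.val.map C * A' * h.val.map C : Matrix (Fin m) (Fin m) (MvPolynomial (Fin n × Fin n) ℂ)) i j = 0) ∧
          P' = Matrix.of fun i j => if a i = b j then
            (g.val.map C * A' * h.val.map C : Matrix (Fin m) (Fin m) (MvPolynomial (Fin n × Fin n) ℂ)) i j else 0) ∧
      (∀ B' : Matrix (Fin m) (Fin m) (MvPolynomial (Fin n × Fin n) ℂ),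
          (∃ (g h : GL (Fin m) ℂ) (a b : Fin m → ℕ),
            (∀ i, (a i : ℕ∞) ≤ ⊤) ∧ (∀ j, (b j : ℕ∞) ≤ ⊤) ∧ ∑ i, a i = ∑ j, b j ∧
            (∀ i j, a i < b j →
              (g.val.map C * P' * h.val.map C : Matrix (Fin m) (Fin m) (MvPolynomial (Fin n × Fin n) ℂ)) i j = 0) ∧
            B' = Matrix.of fun i j => if a i = b j then
              (g.val.map C * P' * h.val.map C : Matrix (Fin m) (Fin m) (MvPolynomial (Fin n × Fin n) ℂ)) i j else 0) →
          (∃ (g h : GL (Fin m) ℂ) (a b : Fin m → ℕ),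
            (∀ i, (a i : ℕ∞) ≤ 0) ∧ (∀ j, (b j : ℕ∞) ≤ 0) ∧ ∑ i, a i = ∑ j, b j ∧
            (∀ i j, a i < b j →
              (g.val.map C * P' * h.val.map C : Matrix (Fin m) (Fin m) (MvPolynomial (Fin n × Fin n) ℂ)) i j = 0) ∧
            B' = Matrix.of fun i j => if a i = b j then
              (g.val.map C * P' * h.val.map C : Matrix (Fin m) (Fin m) (MvPolynomial (Fin n × Fin n) ℂ)) i j else 0)) ∧
      ¬ (∃ (g h : GL (Fin m) ℂ) (a b : Fin m → ℕ),
          (∀ i, (a i : ℕ∞) ≤ 0) ∧ (∀ j, (b j : ℕ∞) ≤ 0) ∧ ∑ i, a i = ∑ j, b j ∧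
          (∀ i j, a i < b j →
            (g.val.map C * A * h.val.map C : Matrix (Fin m) (Fin m) (MvPolynomial (Fin n × Fin n) ℂ)) i j = 0) ∧
          P = Matrix.of fun i j => if a i = b j then
            (g.val.map C * A * h.val.map C : Matrix (Fin m) (Fin m) (MvPolynomial (Fin n × Fin n) ℂ)) i j else 0) ∧
      (∃ (g h : GL (Fin m) ℂ) (a b : Fin m → ℕ),
          (∀ i, (a i : ℕ∞) ≤ 0) ∧ (∀ j, (b j : ℕ∞) ≤ 0) ∧ ∑ i, a i = ∑ j, b j ∧
          (∀ i j, a i < b j →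
            (g.val.map C * P * h.val.map C : Matrix (Fin m) (Fin m) (MvPolynomial (Fin n × Fin n) ℂ)) i j = 0) ∧
          P' = Matrix.of fun i j => if a i = b j then
            (g.val.map C * P * h.val.map C : Matrix (Fin m) (Fin m) (MvPolynomial (Fin n × Fin n) ℂ)) i j else 0) :=
  ⟨1, 2, (!![X (0, 0), 0; 1, X (0, 0)] : Matrix (Fin 2) (Fin 2) (MvPolynomial (Fin 1 × Fin 1) ℂ)),
    (!![X (0, 0), 0; 1, X (0, 0)] : Matrix (Fin 2) (Fin 2) (MvPolynomial (Fin 1 × Fin 1) ℂ)),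
    ((X (0, 0) : MvPolynomial (Fin 1 × Fin 1) ℂ) • (1 : Matrix (Fin 2) (Fin 2) (MvPolynomial (Fin 1 × Fin 1) ℂ))),
    ((X (0, 0) : MvPolynomial (Fin 1 × Fin 1) ℂ) • (1 : Matrix (Fin 2) (Fin 2) (MvPolynomial (Fin 1 × Fin 1) ℂ))),
    ((X (0, 0) : MvPolynomial (Fin 1 × Fin 1) ℂ) • (1 : Matrix (Fin 2) (Fin 2) (MvPolynomial (Fin 1 × Fin 1) ℂ))),
    jh_toy_det _ rfl, jh_toy_deg _ _ rfl rfl, jh_toy_deg _ _ rfl rfl, jh_toy_deg _ _ rfl rfl, jh_scalar_closed _ _ rfl,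
    jh_toy_deg _ _ rfl rfl, jh_scalar_closed _ _ rfl, jh_toy_not_gauge _ _ rfl rfl, jh_deg_refl 0 _⟩

end

end Summit.ValiantsHypothesis.Theorems.OrbitDimensionBound.Negative.FilteredCovering
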